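import Summits.QuantumFields.YangMills.Theorems.LuscherReductionTwistedTraceScalingInnerKernelComparison
import HarnessLib

/-!
# Negative-side bookkeeping R35 for C4 INNER, bricks (ST)/(OD) of COARSE-DESIGN §24.4: ONE-SIDED pointwise domination `0 ≤ K̃ ≤ (1+η₀)·M` by a gapped model kernel `M`
# transfers NEITHER the stiff gap NOR the off-diagonal vanishing to `K̃` — even at `η₀ = 0`; the TWO-SIDED currency `|K̃ − M| ≤ η₀·M` does, with loss `η₀·μ₀(M)` (attained)
# (crux `TwistedTraceScaling` stmt-QuantumFields-20203, skeleton «twolattice» rev 3, stub S-BASE, sub-target C4-CORE; disprover cycle 28, `Cruxes/TwistedTraceScaling/Disproof.lean` §AF)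

Lane A's plan of record for the Born–Oppenheimer package on the soft tube (COARSE-DESIGN §24.4) states the stiff brick as
«(ST) STIFF: `T(v) ≤ (1−θ)σμ₀‖v‖²_w` for `v` fibrewise `⊥ Ω*`: pointwise domination `K̃ ≤ (1+η₀)·M` on core×core by the TWISTED frozen model `M` + the gap of `M` on `Ω*^⊥`».
Read literally (ONE-sided entrywise domination) that inference is invalid, and so is its off-diagonal analogue (OD): every `v ⊥ Ω*` is sign-changing, and a one-sided
entrywise bound controls `Σ vᵢK̃ᵢⱼvⱼ` only through `Σ |vᵢ|Mᵢⱼ|vⱼ| ≤ μ₀(M)‖v‖²` — the TOP of `M`, no gap.  Finite witnesses (all on `Fin 2`, `Ω = (1,1)`, `v = (1,−1)`,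
`M = [[2,1],[1,2]]`: Perron value `μ₀ = 3` on `Ω`, value `g = 1` on `Ω^⊥`):
* `domination_witness` / ★ `not_gap_of_oneSided_domination` — `K = [[2,0],[0,2]]`: `0 ≤ K ≤ M` entrywise (`η₀ = 0`), yet `Σ vKv = 2‖v‖² > g‖v‖²`; the general inference
  rule «entrywise `0 ≤ K ≤ (1+η)M` ∧ `M`-gap `g` on `Ω^⊥` ⟹ `K`-bound `(1+η)g` on `Ω^⊥`» is refuted over every finite index type;
* ★ `not_offdiag_of_oneSided_domination` — `K = [[2,0],[0,1]]`: `0 ≤ K ≤ M`, `Σ ΩMv = 0` for all `v ⊥ Ω`, yet `Σ ΩKv = 1 ≠ 0`: domination does not transfer (OD) either;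
* `not_operator_le_of_entrywise_le` — the same `K = 2·𝟙 ≤ M` entrywise is NOT `≤ M` as a quadratic form (`vᵀ(M−K)v = −2 < 0`): pointwise (Laplace-asymptotic) information is
  not operator order, which is what WOULD transfer a gap;
* `form_le_of_twoSided_near` (+ `form_le_gap_add_of_twoSided_near`) — the valid currency: entrywise `|K − M| ≤ η·M` ⟹ `Σ vKv ≤ Σ vMv + η·Σ|v|M|v|`, hence
  `≤ (g + η·μ₀)‖v‖²` on `Ω^⊥` — the loss is `η·μ₀(M)`, NOT `η·g`;
* ★ `twoSided_loss_attained` — for every `0 ≤ η ≤ 1`, `K_η = [[2(1+η), 1−η],[1−η, 2(1+η)]]` is two-sided `η`-near `M` and `Σ vK_ηv = (g + η·μ₀)‖v‖²` exactly: the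
  loss `η·μ₀` cannot be improved.
READING for lane A (paper, Disproof §AF): the Mehler-currency bricks O′/O′⁺ (`true_boOrth_le`, `true_boOrth_le_add`, `true_boProj_boOrth_add`) already take the TWO-sided
`hnear : |K₂ − k⊗K| ≤ η·k⊗K (+ τ)`; the owed Laplace bricks (ST)/(OD) of §24.4 must therefore be DELIVERED two-sided on core×core (`|K̃ − M| ≤ η₀M`; one-sided/absolute
tails only where `M`'s own form is negligible), with `η₀ ≪ θ` = the fibre gap fraction of `M` (order one in `L`-units at fixed `L`, so `η₀ = o(1)` suffices for (ST), while
SLOW/FLOOR need the additive `κ = o(λ_b)` of `slow_clause_of_bricks` / `floor_clause_of_bricks`).  Nothing here refutes a landed file; it pins the shape of two owed ones.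
HONEST FRAMING: elementary finite-dimensional linear algebra about a stub (S-BASE, C4) of a child of the CONDITIONAL reduction route R2b1; not `¬TwistedTraceScaling`,
not a gap, not Clay.

## References
* B. Helffer, *Spectral Theory and its Applications*, CUP 2013, Lemma 7.1 (Schur's test). [Helffer2013]
* M. Lüscher, Nucl. Phys. B219 (1983) 233, §3. [Luscher1983]
-/

set_option autoImplicit false

namespace Summit.QuantumFields.YangMills.Theorems.TwistedTraceScaling.Negative.R35

open Finset

/-! ## §1 One-sided domination transfers nothing -/

/-- **The witness**: `M = [[2,1],[1,2]]`, `K = 2·𝟙`, `Ω = (1,1)`.  `K` is entrywise between `0` and `M`; `Ω` is `M`'s Perron vector (`MΩ = 3Ω`); on `Ω^⊥` the form of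
`M` is `1·‖v‖²` (gap `1 < 3`) while the form of `K` is `2·‖v‖²` on ALL of `ℝ²` (no gap, and `2 > 1`). [folklore] -/
theorem domination_witness :
    let M : Fin 2 → Fin 2 → ℝ := ![![2, 1], ![1, 2]]
    let K : Fin 2 → Fin 2 → ℝ := ![![2, 0], ![0, 2]]
    let Ω : Fin 2 → ℝ := ![1, 1]
    (∀ i j, 0 ≤ K i j ∧ K i j ≤ M i j) ∧ (∀ i j, M i j = M j i) ∧ (∀ i, ∑ j, M i j * Ω j = 3 * Ω i) ∧
      (∀ v : Fin 2 → ℝ, ∑ i, v i * Ω i = 0 → ∑ i, ∑ j, v i * M i j * v j = 1 * ∑ i, v i ^ 2) ∧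
      (∀ v : Fin 2 → ℝ, ∑ i, ∑ j, v i * K i j * v j = 2 * ∑ i, v i ^ 2) := by
  refine ⟨?_, ?_, ?_, ?_, ?_⟩
  · intro i j; fin_cases i <;> fin_cases j <;> simp
  · intro i j; fin_cases i <;> fin_cases j <;> simp
  · intro i; fin_cases i <;> simp [Fin.sum_univ_two] <;> norm_num
  · intro v hv
    simp only [Fin.sum_univ_two, Matrix.cons_val_zero, Matrix.cons_val_one, Fin.isValue] at hv ⊢
    have h1 : v 1 = -v 0 := by
      have : v 0 * 1 + v 1 * 1 = 0 := by simpa using hv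
      linarith
    simp [h1]; ring
  · intro v
    simp [Fin.sum_univ_two]; ring

/-- ★ **ONE-SIDED DOMINATION DOES NOT TRANSFER A GAP.**  The inference rule «`0 ≤ η`, `M` symmetric, `0 ≤ K ≤ (1+η)·M` entrywise, `Σ vMv ≤ g‖v‖²` for all `v ⊥ Ω`
⟹ `Σ vKv ≤ (1+η)g‖v‖²` for all `v ⊥ Ω`» is FALSE (already for `ι = Fin 2`, `η = 0`, the witness above with `v = (1,−1)`: `4 ≤ 2` fails). [folklore] -/
theorem not_gap_of_oneSided_domination :
    ¬ ∀ (ι : Type) [Fintype ι] (K M : ι → ι → ℝ) (Ω : ι → ℝ) (η g : ℝ), 0 ≤ η → (∀ i j, M i j = M j i) →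
        (∀ i j, 0 ≤ K i j) → (∀ i j, K i j ≤ (1 + η) * M i j) →
        (∀ v : ι → ℝ, ∑ i, v i * Ω i = 0 → ∑ i, ∑ j, v i * M i j * v j ≤ g * ∑ i, v i ^ 2) →
        ∀ v : ι → ℝ, ∑ i, v i * Ω i = 0 → ∑ i, ∑ j, v i * K i j * v j ≤ (1 + η) * g * ∑ i, v i ^ 2 := by
  intro h
  have hM : ∀ v : Fin 2 → ℝ, ∑ i, v i * (![1, 1] : Fin 2 → ℝ) i = 0 →
      ∑ i, ∑ j, v i * (![![2, 1], ![1, 2]] : Fin 2 → Fin 2 → ℝ) i j * v j ≤ 1 * ∑ i, v i ^ 2 := fun v hv =>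
    (domination_witness.2.2.2.1 v hv).le
  have := h (Fin 2) ![![2, 0], ![0, 2]] ![![2, 1], ![1, 2]] ![1, 1] 0 1 le_rfl
    (fun i j => by fin_cases i <;> fin_cases j <;> simp) (fun i j => by fin_cases i <;> fin_cases j <;> simp)
    (fun i j => by fin_cases i <;> fin_cases j <;> simp) hM ![1, -1] (by simp [Fin.sum_univ_two])
  simp [Fin.sum_univ_two] at this
  norm_num at this

/-- ★ **ONE-SIDED DOMINATION DOES NOT TRANSFER THE OFF-DIAGONAL VANISHING.**  «`M` symmetric, `0 ≤ K ≤ M` entrywise, `Σᵢⱼ ΩᵢMᵢⱼvⱼ = 0` for all `v ⊥ Ω` ⟹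
`Σᵢⱼ ΩᵢKᵢⱼvⱼ = 0` for all `v ⊥ Ω`» is FALSE: `M = [[2,1],[1,2]]`, `K = [[2,0],[0,1]]`, `Ω = (1,1)`, `v = (1,−1)` gives `Σ ΩKv = 1`. [folklore] -/
theorem not_offdiag_of_oneSided_domination :
    ¬ ∀ (ι : Type) [Fintype ι] (K M : ι → ι → ℝ) (Ω : ι → ℝ), (∀ i j, M i j = M j i) → (∀ i j, 0 ≤ K i j) → (∀ i j, K i j ≤ M i j) →
        (∀ v : ι → ℝ, ∑ i, v i * Ω i = 0 → ∑ i, ∑ j, Ω i * M i j * v j = 0) →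
        ∀ v : ι → ℝ, ∑ i, v i * Ω i = 0 → ∑ i, ∑ j, Ω i * K i j * v j = 0 := by
  intro h
  have hM : ∀ v : Fin 2 → ℝ, ∑ i, v i * (![1, 1] : Fin 2 → ℝ) i = 0 →
      ∑ i, ∑ j, (![1, 1] : Fin 2 → ℝ) i * (![![2, 1], ![1, 2]] : Fin 2 → Fin 2 → ℝ) i j * v j = 0 := fun v hv => by
    simp only [Fin.sum_univ_two, Matrix.cons_val_zero, Matrix.cons_val_one, Fin.isValue] at hv ⊢
    have h1 : v 1 = -v 0 := by
      have : v 0 * 1 + v 1 * 1 = 0 := by simpa using hv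
      linarith
    simp [h1]
  have := h (Fin 2) ![![2, 0], ![0, 1]] ![![2, 1], ![1, 2]] ![1, 1]
    (fun i j => by fin_cases i <;> fin_cases j <;> simp) (fun i j => by fin_cases i <;> fin_cases j <;> simp)
    (fun i j => by fin_cases i <;> fin_cases j <;> simp) hM ![1, -1] (by simp [Fin.sum_univ_two])
  simp [Fin.sum_univ_two] at this
  norm_num at this

/-- **Entrywise order is not operator order**: the same `K = 2·𝟙 ≤ M = [[2,1],[1,2]]` entrywise has `Σᵢⱼ vᵢ(Mᵢⱼ − Kᵢⱼ)vⱼ = −2 < 0` at `v = (1,−1)` — so `K ≰ M` as forms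
(operator domination WOULD transfer the gap; a pointwise kernel evaluation does not give it). [folklore] -/
theorem not_operator_le_of_entrywise_le :
    ¬ ∀ (ι : Type) [Fintype ι] (K M : ι → ι → ℝ), (∀ i j, M i j = M j i) → (∀ i j, 0 ≤ K i j) → (∀ i j, K i j ≤ M i j) →
        ∀ v : ι → ℝ, ∑ i, ∑ j, v i * K i j * v j ≤ ∑ i, ∑ j, v i * M i j * v j := by
  intro h
  have := h (Fin 2) ![![2, 0], ![0, 2]] ![![2, 1], ![1, 2]]
    (fun i j => by fin_cases i <;> fin_cases j <;> simp) (fun i j => by fin_cases i <;> fin_cases j <;> simp)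
    (fun i j => by fin_cases i <;> fin_cases j <;> simp) ![1, -1]
  simp [Fin.sum_univ_two] at this
  norm_num at this

/-! ## §2 The two-sided currency: valid, with loss `η·μ₀(M)`, and that loss is attained -/

variable {ι : Type*} [Fintype ι]

/-- **Two-sided nearness controls sign-changing forms** (finite Schur bookkeeping): `|K − M| ≤ η·M` entrywise (which forces `η·M ≥ 0`) gives
`Σ vKv ≤ Σ vMv + η·Σ |v|M|v|`. [cite: Helffer2013, Lemma 7.1] -/
theorem form_le_of_twoSided_near {K M : ι → ι → ℝ} {η : ℝ} (hnear : ∀ i j, |K i j - M i j| ≤ η * M i j) (v : ι → ℝ) :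
    ∑ i, ∑ j, v i * K i j * v j ≤ ∑ i, ∑ j, v i * M i j * v j + η * ∑ i, ∑ j, |v i| * M i j * |v j| := by
  have hterm : ∀ i j, v i * K i j * v j ≤ v i * M i j * v j + η * (|v i| * M i j * |v j|) := fun i j => by
    have h1 : v i * (K i j - M i j) * v j ≤ |v i| * (η * M i j) * |v j| := by
      calc v i * (K i j - M i j) * v j ≤ |v i * (K i j - M i j) * v j| := le_abs_self _
        _ = |v i| * |K i j - M i j| * |v j| := by rw [abs_mul, abs_mul]
        _ ≤ |v i| * (η * M i j) * |v j| :=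
            mul_le_mul_of_nonneg_right (mul_le_mul_of_nonneg_left (hnear i j) (abs_nonneg _)) (abs_nonneg _)
    nlinarith [h1]
  calc ∑ i, ∑ j, v i * K i j * v j ≤ ∑ i, ∑ j, (v i * M i j * v j + η * (|v i| * M i j * |v j|)) :=
        sum_le_sum fun i _ => sum_le_sum fun j _ => hterm i j
    _ = ∑ i, ∑ j, v i * M i j * v j + η * ∑ i, ∑ j, |v i| * M i j * |v j| := by
        simp only [sum_add_distrib, mul_sum]

/-- **Gap transfer in the two-sided currency, with loss `η·μ₀`**: if moreover `Σ uMu ≤ μ₀‖u‖²` for all `u` (applied to `|v|`) and `Σ vMv ≤ g‖v‖²` for the given `v`, then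
`Σ vKv ≤ (g + η·μ₀)‖v‖²` (`η ≥ 0`). [cite: Helffer2013, Lemma 7.1] [cite: Luscher1983, §3] -/
theorem form_le_gap_add_of_twoSided_near {K M : ι → ι → ℝ} {η μ₀ g : ℝ} (hη : 0 ≤ η)
    (hnear : ∀ i j, |K i j - M i j| ≤ η * M i j) (htop : ∀ u : ι → ℝ, ∑ i, ∑ j, u i * M i j * u j ≤ μ₀ * ∑ i, u i ^ 2)
    {v : ι → ℝ} (hgap : ∑ i, ∑ j, v i * M i j * v j ≤ g * ∑ i, v i ^ 2) :
    ∑ i, ∑ j, v i * K i j * v j ≤ (g + η * μ₀) * ∑ i, v i ^ 2 := by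
  have h1 := form_le_of_twoSided_near hnear v
  have h2 := htop (fun i => |v i|)
  have h3 : ∑ i, (fun i => |v i|) i ^ 2 = ∑ i, v i ^ 2 := sum_congr rfl fun i _ => by simp [sq_abs]
  rw [h3] at h2
  have h4 : η * ∑ i, ∑ j, |v i| * M i j * |v j| ≤ η * (μ₀ * ∑ i, v i ^ 2) := mul_le_mul_of_nonneg_left h2 hη
  nlinarith [h1, h4, hgap]

/-- ★ **THE LOSS `η·μ₀` IS ATTAINED** (so two-sided nearness certifies a gap on `Ω^⊥` only when `η·μ₀(M) <` the gap `μ₀ − g`): for every `0 ≤ η ≤ 1`,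
`K_η = [[2(1+η), 1−η],[1−η, 2(1+η)]] ≥ 0` is entrywise two-sided `η`-near `M = [[2,1],[1,2]]` (`μ₀ = 3` on `Ω = (1,1)`, `g = 1` on `Ω^⊥`), and at `v = (1,−1) ⊥ Ω`
`Σ vK_ηv = 2 + 6η = (g + η·μ₀)·‖v‖²` exactly. [folklore] -/
theorem twoSided_loss_attained {η : ℝ} (hη0 : 0 ≤ η) (hη1 : η ≤ 1) :
    let M : Fin 2 → Fin 2 → ℝ := ![![2, 1], ![1, 2]]
    let K : Fin 2 → Fin 2 → ℝ := ![![2 * (1 + η), 1 - η], ![1 - η, 2 * (1 + η)]]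
    let v : Fin 2 → ℝ := ![1, -1]
    (∀ i j, 0 ≤ M i j ∧ 0 ≤ K i j) ∧ (∀ i j, |K i j - M i j| ≤ η * M i j) ∧ (∀ u : Fin 2 → ℝ, ∑ i, ∑ j, u i * M i j * u j ≤ 3 * ∑ i, u i ^ 2) ∧
      (∑ i, v i * (![1, 1] : Fin 2 → ℝ) i = 0) ∧ (∑ i, ∑ j, v i * M i j * v j = 1 * ∑ i, v i ^ 2) ∧
      (∑ i, ∑ j, v i * K i j * v j = (1 + η * 3) * ∑ i, v i ^ 2) := by
  refine ⟨?_, ?_, ?_, ?_, ?_, ?_⟩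
  · intro i j; fin_cases i <;> fin_cases j <;> simp <;> linarith
  · intro i j
    fin_cases i <;> fin_cases j <;> simp
    · rw [show 2 * (1 + η) - 2 = 2 * η by ring, abs_of_nonneg (by linarith)]; linarith
    · exact (abs_of_nonneg hη0).le
    · exact (abs_of_nonneg hη0).le
    · rw [show 2 * (1 + η) - 2 = 2 * η by ring, abs_of_nonneg (by linarith)]; linarith
  · intro u
    simp [Fin.sum_univ_two]
    nlinarith [sq_nonneg (u 0 - u 1)]
  · simp [Fin.sum_univ_two]
  · simp [Fin.sum_univ_two]; norm_num
  · simp [Fin.sum_univ_two]; ring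

end Summit.QuantumFields.YangMills.Theorems.TwistedTraceScaling.Negative.R35
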